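/-
Copyright (c) 2026 the pub-hodgecm-mathlib formalisation cell (harness21).  Prover seat hodgecm-mathlib-K2E5-p12 (g2), Track B «K2-LIT» ∕ h413, deal (D29) (δ-U2) of
K2E3-plan (g2) on the §L line lead K2E3-p12 (g3)'s recommendation: FILE C (the trace chart) of `Theorems/K2E3U2NilpotentFourierPointSupport.lean`.  2026-09-04.
-/
import Summits.HodgeConjecture.HodgeConjecture.Theorems.K2E3U2DiscrInvFourthRootLocallyIntegrable    -- ★ FILE B p856763 (this seat): `exists_quadraticCoordinates`; brings ★ FILE A p856741
import HarnessLib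

/-!
# K2 ∕ E3, (δ-U2) FILE C — THE TRACE FORM OF `𝔲₂(H_w)` IS DIAGONAL IN THE QUADRATIC COORDINATES: a chart `e₄ : ↥𝔲(σ_w, H_w) ≃ (L⁺_v)⁴` with
# `tr(X·Y) = ι(Λ s s′ + Λ t t′ − 2r b₁b₁′ + 2rΛ b₂b₂′)`

Cell `pub/hodgecm-mathlib` (D-0151), Track B «K2-LIT», crux H413 = `stmt-HodgeConjecture-24833` (lane `--supports … --as helper`, count-neutral); seat K2E5-p12 (g2);
dealer K2E3-plan (g2) deal (D29) 2026-09-04T02:28Z = §L line lead K2E3-p12 (g3)'s (δ-U2) 02:24:17Z.  THEOREMS ONLY (no definition ∕ instance ∕ notation ∕ named fact ∕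
`sorry`); never imports `Cruxes/…/Lines`.  Consumer: FILE D `Theorems/K2E3U2NilpotentFourierPointSupport.lean` (this seat) — the Fourier transform
`𝓕f(Y) = ∫ ψ(tr(Y·X)) f(X) dμ𝔤` (★ `lieFourier`) preserves `C_c^∞(𝔲₂(H_w))`, transported to ★ `piFourierSB_mem_schwartzBruhat` on `(L⁺_v)⁴` along THIS chart.

THE MATHEMATICS (folklore; [PlatonovRapinchuk1994, §2.3], [Knapp2002, I §8 Example 3], [HarishChandra1999AdmissibleDistributions, §4 p. 11]).  Same frame as ★ FILE A
(`E ⊇ ι(F)`, `σ` fixing `ι(F)`, `σλ = −λ`, `λ² = ι Λ`, `z = ι(re z) + λ ι(im z)`):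
* §1 (generic) **`exists_addEquiv_lieOfForm_diagonal_trace`** — for `a₀, a₁ ≠ 0` with `a₁∕a₀ = ι r`, the chart `X ↦ (im X₀₀, im X₁₁, re X₁₀, im X₁₀)` of
  `𝔲(σ, diag(a₀,a₁)) = {[[λ ι s, −ι r (ι b₁ − λ ι b₂)], [ι b₁ + λ ι b₂, λ ι t]]}` is an additive homeomorphism onto `Fin 4 → F` in which the TRACE FORM IS DIAGONAL:
  `tr(X·Y) = X₀₀Y₀₀ + X₁₁Y₁₁ + (X₀₁Y₁₀ + X₁₀Y₀₁) = ι(Λ s s′ + Λ t t′ − 2r(b₁b₁′ − Λ b₂b₂′))` — coefficients `β = ![Λ, Λ, −2r, 2rΛ]`;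
  `exists_addEquiv_lieOfForm_of_congr'` — pull-back along `X ↦ P⁻¹XP` (as ★ FILE A, exporting the formula `e′ Y = e(P⁻¹YP)`; `tr` is `Ad`-invariant).
* §2 (CM) **`exists_addEquiv_trace_eq`** — at a non-split `w`, for `H ∈ M₂(L)` hermitian with `det H ≠ 0`: an additive homeomorphism `e₄ : ↥𝔲(σ_w,H_w) ≃ (Fin 4 → L⁺_v)` and
  `β : Fin 4 → L⁺_v`, all `βᵢ ≠ 0`, with **`tr(X·Y) = ι(Σᵢ βᵢ (e₄X)ᵢ (e₄Y)ᵢ)`** (diagonalise `H_w` by ★ `Hermitian.exists_congr_diagonal_of_involution`, ★ FILE B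
  `exists_quadraticCoordinates`, §1).  In particular `tr(X·Y) ∈ ι(L⁺_v)` on `𝔲 × 𝔲`, and `ψ(tr(Y·X)) = (ψ ∘ ι)(⟨e₄X, β·e₄Y⟩)`.
HONEST LABEL: HC_CM is proved only modulo the 7 printed citations (2 remaining named inputs: hLiu418 = `stmt-HodgeConjecture-24832`, h413 = `stmt-HodgeConjecture-24833`)
until rung 0 closes; count-neutral helper.

## References
* [PlatonovRapinchuk1994] V. Platonov, A. Rapinchuk, *Algebraic Groups and Number Theory* (1994), §2.3.
* [Knapp2002] A. W. Knapp, *Lie Groups Beyond an Introduction*, 2nd ed. (2002), I §8 Example 3.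
* [HarishChandra1999AdmissibleDistributions] Harish-Chandra (DeBacker–Sally), *Admissible Invariant Distributions on Reductive p-adic Groups* (1999), §4 p. 11 (the pairing `B(X,Y) = tr(XY)`).
-/

set_option autoImplicit false
set_option linter.dupNamespace false   -- `Summit.HodgeConjecture.HodgeConjecture.…` (D-0017 nested layout; lakefile exemption for Summits)

noncomputable section

open scoped Matrix
open NumberField IsDedekindDomain
open Literature.NumberTheory.Automorphic Literature.NumberTheory.Automorphic.UnitaryGroup
open Summit.HodgeConjecture.HodgeConjecture.Cruxes.H413.K2E3LieUnitary (lieOfForm mem_lieOfForm_iff)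
open Summit.HodgeConjecture.HodgeConjecture.Cruxes.H413.K2E3U2LieDiagonalCoordinates
open Summit.HodgeConjecture.HodgeConjecture.Cruxes.H413.K2E3U2DiscrInvFourthRootLocallyIntegrable (exists_quadraticCoordinates)

namespace Summit.HodgeConjecture.HodgeConjecture.Cruxes.H413.K2E3U2LieTraceCoordinates

/-! ## §1  Generic: the trace chart of `𝔲(σ, diag(a₀, a₁))` and its pull-back -/

section Generic

variable {R : Type*} [CommRing R] (σ : R →+* R) {n : Type*} [Fintype n] [DecidableEq n]

/-- **Pull-back of a chart along a change of form, with its formula**: an additive homeomorphism `e : 𝔲(σ, ᵗ(σP)·J·P) ≃ M` yields `e′ : 𝔲(σ, J) ≃ M`,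
`e′ Y = e(P⁻¹YP)`. [cite: PlatonovRapinchuk1994, §2.3] -/
theorem exists_addEquiv_lieOfForm_of_congr' [TopologicalSpace R] [IsTopologicalRing R] {M : Type*} [AddCommGroup M] [TopologicalSpace M]
    (P : (Matrix n n R)ˣ) (J : Matrix n n R)
    (e : ↥(lieOfForm σ (((P : Matrix n n R).map σ)ᵀ * J * (P : Matrix n n R))) ≃+ M) (he : Continuous e) (hes : Continuous e.symm) :
    ∃ e' : ↥(lieOfForm σ J) ≃+ M, Continuous e' ∧ Continuous e'.symm ∧
      ∀ Y : ↥(lieOfForm σ J), ∃ hY : ((P⁻¹ : (Matrix n n R)ˣ) : Matrix n n R) * Y.1 * (P : Matrix n n R) ∈ lieOfForm σ (((P : Matrix n n R).map σ)ᵀ * J * (P : Matrix n n R)),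
        e' Y = e ⟨((P⁻¹ : (Matrix n n R)ˣ) : Matrix n n R) * Y.1 * (P : Matrix n n R), hY⟩ := by
  have hPP : (P : Matrix n n R) * ((P⁻¹ : (Matrix n n R)ˣ) : Matrix n n R) = 1 := by
    rw [← Units.val_mul, mul_inv_cancel, Units.val_one]
  have hPP' : ((P⁻¹ : (Matrix n n R)ˣ) : Matrix n n R) * (P : Matrix n n R) = 1 := by
    rw [← Units.val_mul, inv_mul_cancel, Units.val_one]
  have hback : ∀ X : Matrix n n R, ((P⁻¹ : (Matrix n n R)ˣ) : Matrix n n R) * ((P : Matrix n n R) * X * ((P⁻¹ : (Matrix n n R)ˣ) : Matrix n n R)) * (P : Matrix n n R) = X := by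
    intro X
    calc ((P⁻¹ : (Matrix n n R)ˣ) : Matrix n n R) * ((P : Matrix n n R) * X * ((P⁻¹ : (Matrix n n R)ˣ) : Matrix n n R)) * (P : Matrix n n R)
        = (((P⁻¹ : (Matrix n n R)ˣ) : Matrix n n R) * (P : Matrix n n R)) * X * (((P⁻¹ : (Matrix n n R)ˣ) : Matrix n n R) * (P : Matrix n n R)) := by
          simp only [Matrix.mul_assoc]
      _ = X := by rw [hPP', Matrix.one_mul, Matrix.mul_one]
  have hforth : ∀ Y : Matrix n n R, (P : Matrix n n R) * (((P⁻¹ : (Matrix n n R)ˣ) : Matrix n n R) * Y * (P : Matrix n n R)) * ((P⁻¹ : (Matrix n n R)ˣ) : Matrix n n R) = Y := by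
    intro Y
    calc (P : Matrix n n R) * (((P⁻¹ : (Matrix n n R)ˣ) : Matrix n n R) * Y * (P : Matrix n n R)) * ((P⁻¹ : (Matrix n n R)ˣ) : Matrix n n R)
        = ((P : Matrix n n R) * ((P⁻¹ : (Matrix n n R)ˣ) : Matrix n n R)) * Y * ((P : Matrix n n R) * ((P⁻¹ : (Matrix n n R)ˣ) : Matrix n n R)) := by
          simp only [Matrix.mul_assoc]
      _ = Y := by rw [hPP, Matrix.one_mul, Matrix.mul_one]
  let κ : ↥(lieOfForm σ J) ≃+ ↥(lieOfForm σ (((P : Matrix n n R).map σ)ᵀ * J * (P : Matrix n n R))) :=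
    { toFun := fun Y => ⟨((P⁻¹ : (Matrix n n R)ˣ) : Matrix n n R) * Y.1 * (P : Matrix n n R), (mem_lieOfForm_iff_units_conj_mem σ P J Y.1).1 Y.2⟩
      invFun := fun X => ⟨(P : Matrix n n R) * X.1 * ((P⁻¹ : (Matrix n n R)ˣ) : Matrix n n R), by
        rw [mem_lieOfForm_iff_units_conj_mem σ P J, hback]
        exact X.2⟩
      left_inv := fun Y => Subtype.ext (hforth Y.1)
      right_inv := fun X => Subtype.ext (hback X.1)
      map_add' := fun Y Z => Subtype.ext (by
        show ((P⁻¹ : (Matrix n n R)ˣ) : Matrix n n R) * (Y.1 + Z.1) * (P : Matrix n n R) =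
          ((P⁻¹ : (Matrix n n R)ˣ) : Matrix n n R) * Y.1 * (P : Matrix n n R) + ((P⁻¹ : (Matrix n n R)ˣ) : Matrix n n R) * Z.1 * (P : Matrix n n R)
        rw [Matrix.mul_add, Matrix.add_mul]) }
  have hκ : Continuous κ := continuous_induced_rng.2 <|
    show Continuous (fun Y : ↥(lieOfForm σ J) => ((P⁻¹ : (Matrix n n R)ˣ) : Matrix n n R) * Y.1 * (P : Matrix n n R)) from
      (continuous_const.mul continuous_subtype_val).mul continuous_const
  have hκs : Continuous κ.symm := continuous_induced_rng.2 <|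
    show Continuous (fun X : ↥(lieOfForm σ (((P : Matrix n n R).map σ)ᵀ * J * (P : Matrix n n R))) =>
        (P : Matrix n n R) * X.1 * ((P⁻¹ : (Matrix n n R)ˣ) : Matrix n n R)) from
      (continuous_const.mul continuous_subtype_val).mul continuous_const
  exact ⟨κ.trans e, he.comp hκ, hκs.comp hes, fun Y => ⟨(mem_lieOfForm_iff_units_conj_mem σ P J Y.1).1 Y.2, rfl⟩⟩

omit [DecidableEq n] in
/-- `tr((P⁻¹XP)(P⁻¹YP)) = tr(XY)` (`tr(AB) = tr(BA)`). [cite: HarishChandra1999AdmissibleDistributions, §4 p. 11] -/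
theorem trace_units_conj_mul_units_conj [DecidableEq n] (P : (Matrix n n R)ˣ) (X Y : Matrix n n R) :
    Matrix.trace ((((P⁻¹ : (Matrix n n R)ˣ) : Matrix n n R) * X * (P : Matrix n n R)) * (((P⁻¹ : (Matrix n n R)ˣ) : Matrix n n R) * Y * (P : Matrix n n R))) =
      Matrix.trace (X * Y) := by
  have hPP : (P : Matrix n n R) * ((P⁻¹ : (Matrix n n R)ˣ) : Matrix n n R) = 1 := by
    rw [← Units.val_mul, mul_inv_cancel, Units.val_one]
  calc Matrix.trace ((((P⁻¹ : (Matrix n n R)ˣ) : Matrix n n R) * X * (P : Matrix n n R)) * (((P⁻¹ : (Matrix n n R)ˣ) : Matrix n n R) * Y * (P : Matrix n n R)))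
      = Matrix.trace (((P⁻¹ : (Matrix n n R)ˣ) : Matrix n n R) * (X * ((P : Matrix n n R) * ((P⁻¹ : (Matrix n n R)ˣ) : Matrix n n R)) * Y * (P : Matrix n n R))) := by
        simp only [Matrix.mul_assoc]
    _ = Matrix.trace (((P⁻¹ : (Matrix n n R)ˣ) : Matrix n n R) * ((X * Y) * (P : Matrix n n R))) := by rw [hPP, Matrix.mul_one, Matrix.mul_assoc]
    _ = Matrix.trace (((X * Y) * (P : Matrix n n R)) * ((P⁻¹ : (Matrix n n R)ˣ) : Matrix n n R)) := Matrix.trace_mul_comm _ _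
    _ = Matrix.trace (X * Y) := by rw [Matrix.mul_assoc, hPP, Matrix.mul_one]

end Generic

section Diagonal

variable {F E : Type*} [Field F] [Field E] [TopologicalSpace F] [TopologicalSpace E] [IsTopologicalRing E]
  (σ : E →+* E) (ι : F →+* E) (hι : Continuous ι) (lam : E) (ρ : E → F × F) (hρc : Continuous ρ)
  (hρ1 : ∀ z, ι (ρ z).1 + lam * ι (ρ z).2 = z) (hρ2 : ∀ r i, ρ (ι r + lam * ι i) = (r, i))
  (hσι : ∀ r, σ (ι r) = ι r) (hσl : σ lam = -lam) (h2 : (2 : E) ≠ 0)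

include hι hρc hρ1 hρ2 hσι hσl h2 in
/-- **THE TRACE CHART OF `𝔲(σ, diag(a₀, a₁))`.**  For `a_i ≠ 0`, `a₁∕a₀ = ι r`, `λ² = ι Λ`: the chart `X ↦ (im X₀₀, im X₁₁, re X₁₀, im X₁₀)` is an additive
homeomorphism `e : 𝔲 ≃ (Fin 4 → F)` (inverse `(s, t, b₁, b₂) ↦ [[λ ι s, −ι r (ι b₁ − λ ι b₂)], [ι b₁ + λ ι b₂, λ ι t]]`) with
**`tr(X·Y) = ι(Λ s s′ + Λ t t′ − 2r b₁b₁′ + 2rΛ b₂b₂′) = ι(Σᵢ βᵢ (eX)ᵢ (eY)ᵢ)`, `β = ![Λ, Λ, −2r, 2rΛ]`**.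
[cite: Knapp2002, I §8 Example 3] [cite: HarishChandra1999AdmissibleDistributions, §4 p. 11] [cite: PlatonovRapinchuk1994, §2.3] -/
theorem exists_addEquiv_lieOfForm_diagonal_trace (a : Fin 2 → E) (ha0 : ∀ i, a i ≠ 0) (r d : F) (hr : ι r = a 1 / a 0) (hd : lam * lam = ι d) :
    ∃ e : ↥(lieOfForm σ (Matrix.diagonal a)) ≃+ (Fin 4 → F), Continuous e ∧ Continuous e.symm ∧
      ∀ X Y : ↥(lieOfForm σ (Matrix.diagonal a)),
        Matrix.trace (X.1 * Y.1) = ι (∑ i : Fin 4, (![d, d, -2 * r, 2 * r * d] i) * (e X) i * (e Y) i) := by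
  have har : a 0 * ι r = a 1 := by rw [hr]; have := ha0 0; field_simp
  -- the inverse chart
  let g : (Fin 4 → F) → Matrix (Fin 2) (Fin 2) E := fun x =>
    !![lam * ι (x 0), -(ι r) * (ι (x 2) - lam * ι (x 3)); ι (x 2) + lam * ι (x 3), lam * ι (x 1)]
  have hg00 : ∀ x, g x 0 0 = lam * ι (x 0) := fun x => rfl
  have hg01 : ∀ x, g x 0 1 = -(ι r) * (ι (x 2) - lam * ι (x 3)) := fun x => rfl
  have hg10 : ∀ x, g x 1 0 = ι (x 2) + lam * ι (x 3) := fun x => rfl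
  have hg11 : ∀ x, g x 1 1 = lam * ι (x 1) := fun x => rfl
  have hgmem : ∀ x, g x ∈ lieOfForm σ (Matrix.diagonal a) := by
    intro x
    rw [mem_lieOfForm_diagonal_iff]
    intro j k
    fin_cases j <;> fin_cases k
    · show σ (g x 0 0) * a 0 + a 0 * g x 0 0 = 0
      rw [hg00, map_mul, hσl, hσι]; ring
    · show σ (g x 1 0) * a 1 + a 0 * g x 0 1 = 0
      rw [hg10, hg01, map_add, map_mul, hσι, hσι, hσl]; linear_combination (-(ι (x 2)) + lam * ι (x 3)) * har
    · show σ (g x 0 1) * a 0 + a 1 * g x 1 0 = 0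
      rw [hg01, hg10, map_mul, map_neg, map_sub, map_mul, hσι, hσι, hσι, hσl]; linear_combination (-(ι (x 2)) - lam * ι (x 3)) * har
    · show σ (g x 1 1) * a 1 + a 1 * g x 1 1 = 0
      rw [hg11, map_mul, hσl, hσι]; ring
  -- the chart
  let f : Matrix (Fin 2) (Fin 2) E → (Fin 4 → F) := fun X => ![(ρ (X 0 0)).2, (ρ (X 1 1)).2, (ρ (X 1 0)).1, (ρ (X 1 0)).2]
  have hf0 : ∀ X, f X 0 = (ρ (X 0 0)).2 := fun X => rfl
  have hf1 : ∀ X, f X 1 = (ρ (X 1 1)).2 := fun X => rfl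
  have hf2 : ∀ X, f X 2 = (ρ (X 1 0)).1 := fun X => rfl
  have hf3 : ∀ X, f X 3 = (ρ (X 1 0)).2 := fun X => rfl
  have hfg : ∀ x, f (g x) = x := by
    intro x
    have h0 : g x 0 0 = ι 0 + lam * ι (x 0) := by rw [hg00, map_zero, zero_add]
    have h1 : g x 1 1 = ι 0 + lam * ι (x 1) := by rw [hg11, map_zero, zero_add]
    funext i
    fin_cases i
    · show f (g x) 0 = x 0
      rw [hf0, h0, hρ2]
    · show f (g x) 1 = x 1
      rw [hf1, h1, hρ2]
    · show f (g x) 2 = x 2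
      rw [hf2, hg10, hρ2]
    · show f (g x) 3 = x 3
      rw [hf3, hg10, hρ2]
  have hgf : ∀ X : ↥(lieOfForm σ (Matrix.diagonal a)), g (f X.1) = X.1 := by
    intro X
    have hX := (mem_lieOfForm_diagonal_iff σ a X.1).1 X.2
    have hsk0 : σ (X.1 0 0) = -X.1 0 0 := by
      have h := hX 0 0
      have h' : a 0 * (σ (X.1 0 0) + X.1 0 0) = 0 := by linear_combination h
      exact eq_neg_of_add_eq_zero_left ((mul_eq_zero.1 h').resolve_left (ha0 0))
    have hsk1 : σ (X.1 1 1) = -X.1 1 1 := by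
      have h := hX 1 1
      have h' : a 1 * (σ (X.1 1 1) + X.1 1 1) = 0 := by linear_combination h
      exact eq_neg_of_add_eq_zero_left ((mul_eq_zero.1 h').resolve_left (ha0 1))
    have h01 : X.1 0 1 = -(ι r) * σ (X.1 1 0) := by
      have h := hX 0 1
      have h' : a 0 * (X.1 0 1 + ι r * σ (X.1 1 0)) = 0 := by linear_combination h + σ (X.1 1 0) * har
      rw [neg_mul]
      exact eq_neg_of_add_eq_zero_left ((mul_eq_zero.1 h').resolve_left (ha0 0))
    ext i j
    fin_cases i <;> fin_cases j
    · show g (f X.1) 0 0 = X.1 0 0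
      rw [hg00, hf0]
      exact (eq_lam_mul_of_skew σ ι lam ρ hρ1 hσι hσl h2 hsk0).symm
    · show g (f X.1) 0 1 = X.1 0 1
      rw [hg01, hf2, hf3, h01, σ_eq_sub σ ι lam ρ hρ1 hσι hσl (X.1 1 0)]
    · show g (f X.1) 1 0 = X.1 1 0
      rw [hg10, hf2, hf3]
      exact hρ1 _
    · show g (f X.1) 1 1 = X.1 1 1
      rw [hg11, hf1]
      exact (eq_lam_mul_of_skew σ ι lam ρ hρ1 hσι hσl h2 hsk1).symm
  let e' : (Fin 4 → F) ≃+ ↥(lieOfForm σ (Matrix.diagonal a)) :=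
    { toFun := fun x => ⟨g x, hgmem x⟩
      invFun := fun X => f X.1
      left_inv := fun x => hfg x
      right_inv := fun X => Subtype.ext (hgf X)
      map_add' := fun x y => Subtype.ext (by
        show g (x + y) = g x + g y
        ext i j
        fin_cases i <;> fin_cases j
        · show g (x + y) 0 0 = g x 0 0 + g y 0 0
          simp only [hg00, Pi.add_apply, map_add]; ring
        · show g (x + y) 0 1 = g x 0 1 + g y 0 1
          simp only [hg01, Pi.add_apply, map_add]; ring
        · show g (x + y) 1 0 = g x 1 0 + g y 1 0
          simp only [hg10, Pi.add_apply, map_add]; ring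
        · show g (x + y) 1 1 = g x 1 1 + g y 1 1
          simp only [hg11, Pi.add_apply, map_add]; ring) }
  -- continuity
  have hgc : Continuous g := by
    have hz : ∀ i : Fin 4, Continuous fun x : Fin 4 → F => ι (x i) := fun i => hι.comp (continuous_apply i)
    refine continuous_matrix fun i j => ?_
    fin_cases i <;> fin_cases j
    · exact continuous_const.mul (hz 0)
    · exact continuous_const.mul ((hz 2).sub (continuous_const.mul (hz 3)))
    · exact (hz 2).add (continuous_const.mul (hz 3))
    · exact continuous_const.mul (hz 1)
  have hfc : Continuous fun X : ↥(lieOfForm σ (Matrix.diagonal a)) => f X.1 := by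
    have hv : Continuous fun X : ↥(lieOfForm σ (Matrix.diagonal a)) => (X.1 : Matrix (Fin 2) (Fin 2) E) := continuous_subtype_val
    have hs : Continuous fun X : ↥(lieOfForm σ (Matrix.diagonal a)) => ρ (X.1 0 0) := hρc.comp (hv.matrix_elem 0 0)
    have ht : Continuous fun X : ↥(lieOfForm σ (Matrix.diagonal a)) => ρ (X.1 1 1) := hρc.comp (hv.matrix_elem 1 1)
    have hb : Continuous fun X : ↥(lieOfForm σ (Matrix.diagonal a)) => ρ (X.1 1 0) := hρc.comp (hv.matrix_elem 1 0)
    refine continuous_pi fun i => ?_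
    fin_cases i
    · exact continuous_snd.comp hs
    · exact continuous_snd.comp ht
    · exact continuous_fst.comp hb
    · exact continuous_snd.comp hb
  refine ⟨e'.symm, hfc, hgc.subtype_mk _, fun X Y => ?_⟩
  -- the trace form in coordinates
  have hX : X.1 = g (f X.1) := (hgf X).symm
  have hY : Y.1 = g (f Y.1) := (hgf Y).symm
  set x := f X.1 with hx
  set y := f Y.1 with hy
  show Matrix.trace (X.1 * Y.1) = ι (∑ i : Fin 4, (![d, d, -2 * r, 2 * r * d] i) * x i * y i)
  rw [hX, hY, Matrix.trace_fin_two, Matrix.mul_apply, Matrix.mul_apply, Fin.sum_univ_two, Fin.sum_univ_two, hg00, hg01, hg10, hg11, hg00, hg01, hg10, hg11,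
    Fin.sum_univ_four]
  simp only [Matrix.cons_val_zero, Matrix.cons_val_one, Matrix.cons_val_two, Matrix.cons_val_three, Matrix.head_cons, Matrix.tail_cons, map_add, map_mul,
    map_neg, map_ofNat]
  linear_combination (ι (x 0) * ι (y 0) + ι (x 1) * ι (y 1) + 2 * ι r * ι (x 3) * ι (y 3)) * hd

end Diagonal

/-! ## §2  CM: the trace chart of `𝔲(σ_w, H_w)` at a non-split place -/

section CM

variable (L : Type) [Field L] [NumberField L] [IsCMField L] (v : HeightOneSpectrum (𝓞 ↥(maximalRealSubfield L)))
  (w : UnitaryGroup.PlacesOver L v) (hw : IsCMField.complexConj L • w.1 = w.1)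

include hw in
/-- **THE TRACE CHART OF `𝔲₂(H_w)` AT A NON-SPLIT PLACE.**  For `H ∈ M₂(L)` hermitian with `det H ≠ 0`: an additive homeomorphism `e₄ : ↥𝔲(σ_w, H_w) ≃ (Fin 4 → L⁺_v)`
and `β : Fin 4 → L⁺_v` with all `βᵢ ≠ 0` and **`tr(X·Y) = ι(Σᵢ βᵢ (e₄X)ᵢ (e₄Y)ᵢ)`** for all `X, Y ∈ 𝔲` (`ι = toPlace v w`): diagonalise `H_w` over `L_w` (★
`Hermitian.exists_congr_diagonal_of_involution`), descend `a₁∕a₀ = ι r`, take the quadratic coordinates of ★ FILE B, the chart of §1 on `𝔲(diag a)`, and pull back along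
`X ↦ P⁻¹XP` (`tr` is `Ad`-invariant). [cite: PlatonovRapinchuk1994, §2.3] [cite: HarishChandra1999AdmissibleDistributions, §4 p. 11] -/
theorem exists_addEquiv_trace_eq (H : Matrix (Fin 2) (Fin 2) L) (hH : (H.map (cmConjRingHom L))ᵀ = H) (hdet : H.det ≠ 0) :
    ∃ (e : ↥(lieOfForm (galAdicCompletionMap (L := L) (IsCMField.complexConj L) hw) (UnitaryGroup.placeForm H w.1)) ≃+ (Fin 4 → v.adicCompletion ↥(maximalRealSubfield L)))
      (β : Fin 4 → v.adicCompletion ↥(maximalRealSubfield L)), Continuous e ∧ Continuous e.symm ∧ (∀ i, β i ≠ 0) ∧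
      ∀ X Y : ↥(lieOfForm (galAdicCompletionMap (L := L) (IsCMField.complexConj L) hw) (UnitaryGroup.placeForm H w.1)),
        Matrix.trace (X.1 * Y.1) = toPlace v w (∑ i : Fin 4, β i * (e X) i * (e Y) i) := by
  classical
  haveI : Algebra.IsQuadraticExtension ↥(maximalRealSubfield L) L := IsCMField.isQuadraticExtension L
  have hc1 := IsCMField.complexConj_ne_one L
  have hσσ : ∀ x, galAdicCompletionMap (L := L) (IsCMField.complexConj L) hw (galAdicCompletionMap (L := L) (IsCMField.complexConj L) hw x) = x :=
    galAdicCompletionMap_galAdicCompletionMap_of_smul_eq (IsCMField.complexConj L) w hc1 hw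
  have hσι : ∀ r, galAdicCompletionMap (L := L) (IsCMField.complexConj L) hw (toPlace v w r) = toPlace v w r := fun r =>
    (galAdicCompletionMap_eq_self_iff_mem_range (IsCMField.complexConj L) hc1 v w hw _).2 ⟨r, rfl⟩
  have h2 : (2 : w.1.adicCompletion L) ≠ 0 := two_ne_zero
  have hJ : (UnitaryGroup.placeForm H w.1)ᵀ.map (galAdicCompletionMap (L := L) (IsCMField.complexConj L) hw) = UnitaryGroup.placeForm H w.1 := by
    rw [← Matrix.transpose_map]
    exact Literature.NumberTheory.Rogawski1990.placeForm_map_transpose_of_hermitian L v w hw H hH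
  have hJdet : (UnitaryGroup.placeForm H w.1).det ≠ 0 := by
    rw [show UnitaryGroup.placeForm H w.1 = (algebraMap L (w.1.adicCompletion L)).mapMatrix H from rfl, ← RingHom.map_det]
    exact (map_ne_zero _).2 hdet
  obtain ⟨P, hPdet, a, ha, ha0, hPJP⟩ := Literature.NumberTheory.QuadraticForms.Hermitian.exists_congr_diagonal_of_involution hσσ
    ⟨1, by rw [map_one, one_add_one_eq_two]; exact h2⟩ (UnitaryGroup.placeForm H w.1) hJ hJdet
  have hPu : IsUnit P := (Matrix.isUnit_iff_isUnit_det P).2 hPdet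
  obtain ⟨r, hr⟩ := (galAdicCompletionMap_eq_self_iff_mem_range (IsCMField.complexConj L) hc1 v w hw (a 1 / a 0)).1 (by rw [map_div₀, ha, ha])
  have hr' : toPlace v w r = a 1 / a 0 := hr
  have hr0 : r ≠ 0 := by
    intro h
    rw [h, map_zero] at hr'
    exact div_ne_zero (ha0 1) (ha0 0) hr'.symm
  obtain ⟨lam, d, ρ, hσl, hll, hd0, hρc, hρ1, hρ2⟩ := exists_quadraticCoordinates L v w hw
  obtain ⟨eD, heD, heDs, htr⟩ := exists_addEquiv_lieOfForm_diagonal_trace (galAdicCompletionMap (L := L) (IsCMField.complexConj L) hw) (toPlace v w)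
    (continuous_toPlace v w) lam ρ hρc hρ1 hρ2 hσι hσl h2 a ha0 r d hr' hll
  have hD : Matrix.diagonal a = ((hPu.unit : Matrix (Fin 2) (Fin 2) (w.1.adicCompletion L)).map
      (galAdicCompletionMap (L := L) (IsCMField.complexConj L) hw))ᵀ * UnitaryGroup.placeForm H w.1 * (hPu.unit : Matrix (Fin 2) (Fin 2) (w.1.adicCompletion L)) := by
    rw [IsUnit.unit_spec, ← Matrix.transpose_map]
    exact hPJP.symm
  have key : ∀ D : Matrix (Fin 2) (Fin 2) (w.1.adicCompletion L),
      D = ((hPu.unit : Matrix (Fin 2) (Fin 2) (w.1.adicCompletion L)).map (galAdicCompletionMap (L := L) (IsCMField.complexConj L) hw))ᵀ *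
        UnitaryGroup.placeForm H w.1 * (hPu.unit : Matrix (Fin 2) (Fin 2) (w.1.adicCompletion L)) →
      (∃ eD : ↥(lieOfForm (galAdicCompletionMap (L := L) (IsCMField.complexConj L) hw) D) ≃+ (Fin 4 → v.adicCompletion ↥(maximalRealSubfield L)),
        Continuous eD ∧ Continuous eD.symm ∧
        ∀ X Y : ↥(lieOfForm (galAdicCompletionMap (L := L) (IsCMField.complexConj L) hw) D),
          Matrix.trace (X.1 * Y.1) = toPlace v w (∑ i : Fin 4, (![d, d, -2 * r, 2 * r * d] i) * (eD X) i * (eD Y) i)) →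
      ∃ e : ↥(lieOfForm (galAdicCompletionMap (L := L) (IsCMField.complexConj L) hw) (UnitaryGroup.placeForm H w.1)) ≃+ (Fin 4 → v.adicCompletion ↥(maximalRealSubfield L)),
        Continuous e ∧ Continuous e.symm ∧
        ∀ X Y : ↥(lieOfForm (galAdicCompletionMap (L := L) (IsCMField.complexConj L) hw) (UnitaryGroup.placeForm H w.1)),
          Matrix.trace (X.1 * Y.1) = toPlace v w (∑ i : Fin 4, (![d, d, -2 * r, 2 * r * d] i) * (e X) i * (e Y) i) := by
    rintro D rfl ⟨eD, heD, heDs, htr⟩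
    obtain ⟨e', he', he's, hcorr⟩ := exists_addEquiv_lieOfForm_of_congr' (galAdicCompletionMap (L := L) (IsCMField.complexConj L) hw) hPu.unit
      (UnitaryGroup.placeForm H w.1) eD heD heDs
    refine ⟨e', he', he's, fun X Y => ?_⟩
    obtain ⟨hX, hXe⟩ := hcorr X
    obtain ⟨hY, hYe⟩ := hcorr Y
    rw [hXe, hYe, ← htr, trace_units_conj_mul_units_conj]
  obtain ⟨e, he, hes, htr'⟩ := key (Matrix.diagonal a) hD ⟨eD, heD, heDs, htr⟩
  refine ⟨e, ![d, d, -2 * r, 2 * r * d], he, hes, fun i => ?_, htr'⟩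
  fin_cases i
  · exact hd0
  · exact hd0
  · exact mul_ne_zero (neg_ne_zero.2 (by norm_num)) hr0
  · exact mul_ne_zero (mul_ne_zero (by norm_num) hr0) hd0

end CM

end Summit.HodgeConjecture.HodgeConjecture.Cruxes.H413.K2E3U2LieTraceCoordinates

end
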